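import Summits.RiemannHypothesis.RiemannHypothesis.Theorems.LiTailLaguerreDefs
import HarnessLib

/-!
# RiemannHypothesis / LI column — vocabulary PART M and the rung leaf «Li TAIL MIDPOINT LAW» (RH-FREE, all `n`)

Cell `pub/rh-li` (D-0040/D-0059/D-0061), theory round 8 (gen 10; dossier `theory/route/r8/README-R8.md`), successor of
PART K (`Theorems/LiTailLaguerreDefs.lean`, leaf `LiZeroTailLaguerre`, route `Theses/LiTailLaguerre.lean` CLOSED·proved,
`liZeroTailLaguerre_proof`).  Statement-only module (`def`s + `@[conjecture]` targets + PROVED glue; no `sorry`, no axioms).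

THE LAW (leaf `LiZeroTailMidpoint`).  PART K's law says: for a cutoff `c > 0` OFF the resonances (`log m ≠ 1/c²` for
every prime power `m`) the Li-weighted zeros above height `c√n`, minus their Riemann–von Mangoldt mean, equal MINUS the
exact Laguerre terms `liCoffeyTerm m n = (Λ(m)/m) L¹_{n−1}(log m)` of the prime powers `m < e^{1/c²}`, up to
`O_c(log² n)`; the constant `C_c` blows up as `c` approaches a resonance `c_m := (log m)^{−1/2}` (`liResonantScale m`;
`1.2011, 0.9542, 0.8493, 0.7884, 0.7169, 0.6934, …` for `m = 2, 3, 4, 5, 7, 8, …`), where the stationary height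
`t₀(m) = √(n/log m − ¼)` of `m`'s bridge term sits ON the cut.  THE MIDPOINT LAW fills in the one excluded case: AT
`c = c_m` (`m` a prime power) and for all `n ≥ 2`,
`| liZeroTail n (c_m√n) − liSmoothTail n (c_m√n) + Σ_{2 ≤ m' < m} liCoffeyTerm m' n + ½·liCoffeyTerm m n | ≤ C_m log² n`
— the tail releases EXACTLY HALF of the resonant term.  With PART K this gives the law for EVERY `c > 0` with the
MIDPOINT CONVENTION `w_c(m) = 1, ½, 0` for `log m <, =, > 1/c²` (`liMidpointWeight`; unified target `LiZeroTailLaguerreAll`,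
glue `liZeroTailLaguerreAll_of` PROVED below): the Li tail law obeys the same midpoint convention as the normalised
Chebyshev function `ψ₀(x) = ½(ψ(x⁺) + ψ(x⁻))` in the Riemann–von Mangoldt explicit formula, with the roles of the primes and
the zeros exchanged (there the ZERO sum is truncated and the PRIME side takes the midpoint value at a jump; here the zero
sum is cut at a height and the prime power whose stationary height is the cut enters with weight ½).

RH-FREE FOR ALL `n` (rule 4 label), exactly as PART K: `liZeroTail` sums every zero above the cut whatever its real part
(Bombieri–Lagarias, absolutely convergent); the truth value of the leaf does not depend on RH and nothing here bears on the
truth of RH; it is PROOF-OF-DATA and NOT height-buying.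

DATA (all certified inputs; nothing here is evidence for RH).  rh-li-eng-6 g4, ROUND-7 DATA EXHIBIT no. 2 «HALF-RELEASE AT
RESONANCE», PRE-REGISTERED, PASS ×6 (kit j258978, 1 c × 95 s; report `step0/reports/STEP0-REPORT-r7-resonance-halfrelease.md`
sha 78ceefbf6abcc479; rows `step0/reports/r7resonance_j258978/` d78b39198ad2136c, 8 398 certified rows; machinery of exhibit
no. 1: Arb zeros/windows/exact Laguerre, balls of radius ≤ 5.45e-10, `c = 1` control vs ET2 to 5e-14 at 221/221 `n`):
at `c = c_m` for `m ∈ {2, 3, 4, 5, 7, 8}` and 221 log-spaced `n ∈ [10³, 10⁷]` the residual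
`R_half := D_tail(n; c_m) + Σ_{log m' < log m} liCoffeyTerm m' n + ½ liCoffeyTerm m n` has band rms FLAT `0.8–1.9` (growth
exponents `+0.006 … +0.069`), while the 0-weighted and 1-weighted residuals rise like `½|E_m(n)| ~ n^{1/4}` (growth
`0.08–0.21`; e.g. `m = 2`, `n = 10⁷`: `D_tail = +5.219`, `R_half = −0.191`, `R_full = −5.601`, `E₂ = 10.82`).  Exhibits
no. 3/4 (uniform Fresnel transition in `X ≍ (c − c_m) n^{1/4}`, Backlund boundary term; reports r7-uniform-fresnel-law
61fff47cd5b293a3, r7-boundary-term 71753c24459d3202) refine the picture to an `O(1)` law (rms 0.22) and are the booked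
ROUND-9 target; they are not used here.  The typed `O(log² n)` is generous (empirically `O(1)`).

MECHANISM (route `Theses/LiTailMidpoint.lean`).  PART K's half-strip architecture VERBATIM (all four of its cruxes are
tree theorems for every `c > 0`: `liTailContour_proof`, `liGammaTailShift_proof`, `liTailHorizontal_proof`, supports
`liPolarTailBound`, `liTailAdjust`), with ONE change in the prime piece: every `m' ≠ m` is treated exactly as in
`liPrimeTailLaguerre_proof` (released `m' < m` with gap `≥ ½ log(m/(m−1))`, non-released `m' > m` with gap
`≥ ½ log((m+1)/m)`), and the resonant `m` is shifted to the critical line WITHOUT evaluating its `[0, T]` piece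
(`PrimeTail.setIntegral_termIntegrand_eq`, `re_setIntegral_G_half`, `norm_connector_le` — no gap needed), leaving the
PARTIAL LAGUERRE BRIDGE `liBridgeTail n (log m) T = ∫_T^∞ 2(1 − cos nθ(t)) cos(t log m) dt` above the cut (crux
`LiPrimeTailResonant`).  The new analysis is the crux `LiBridgeHalves`: THE BRIDGE IS HALVED BY ITS STATIONARY HEIGHT,
`liBridgeTail n (log m) T = ½·π e^{−(log m)/2} L¹_{n−1}(log m) + O_m(log n)` for `T ∈ [c_m√n, c_m√n + 1]` — because
`∫_T^∞ − ½∫_0^∞ = ½(∫_T^∞ − ∫_0^T)` and the two ONE-SIDED stationary-phase integrals have the SAME half-Fresnel main term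
(`Literature.Analysis.Fourier.LogStatPhaseHyp.norm_integral_sub_main_le`, Graham–Kolesnik Lemma 3.4 one-sided, and its
reflection; first-derivative test away from `[t₀/2, 2t₀]`); the `n^{1/4}` chirp is again never evaluated.
Sources: PART K's record; Graham–Kolesnik 1991 Lemma 3.4 / Titchmarsh 1986 Lemma 4.6 (one-sided form in tree); Davenport
*Multiplicative Number Theory* ch. 17 (the midpoint convention `ψ₀` of the truncated explicit formula — the dual picture).

FENCES.  (i) As PART K: RH-equivalent statements are NOT targets; the law is a statement about the zeros of height
`> c_m√n`, consistent with any zero configuration obeying the known density theorems.  (ii) `LiZeroTailLaguerreAll` is a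
typed target closed by the glue from the two leaves, NOT a route item.  (iii) `liBridgeTail n y 0` is PART K's complete
bridge (`PrimeTail.integral_bridge_eq`: `= π e^{−y/2} liLaguerreOne n y` for `n ≥ 1`, `y > 0`).
-/

noncomputable section

-- D-0017: `Summit.<S>.<S>.…` is the designed namespace of a single-problem summit.
set_option linter.dupNamespace false

open MeasureTheory intervalIntegral
open scoped ArithmeticFunction.vonMangoldt

namespace Summit.RiemannHypothesis.RiemannHypothesis.Theorems.LiTheory

open Literature.NumberTheory.LFunctions

/-! ## PART M — vocabulary -/

/-- The RESONANT SCALE of `m`: `c_m = (log m)^{−1/2}`, the cutoff scale at which the stationary height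
`t₀(m) = √(n/log m − ¼)` of the bridge term of the prime power `m` lies on the cut `c√n` (up to `O(n^{−1/2})`):
`c_2 = 1.2011…`, `c_3 = 0.9542…`, `c_4 = 0.8493…`, `c_5 = 0.7884…` (`= 0` for `m ≤ 1` by the junk value `√(log m) = 0`). -/
def liResonantScale (m : ℕ) : ℝ :=
  1 / Real.sqrt (Real.log m)

/-- The PARTIAL LAGUERRE BRIDGE above height `T` at frequency `y`: `∫_T^∞ 2(1 − cos nθ(t)) cos(ty) dt`
(`θ = liZeroAngle`; integrand `≤ 8(n+1)²/(1+t²)`, `PrimeTail.norm_bridgeIntegrand_le`).  For `T = 0`, `n ≥ 1`, `y > 0` it is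
the complete bridge `π e^{−y/2} liLaguerreOne n y` (`PrimeTail.integral_bridge_eq`); after the shift to the critical line the
resonant prime power `m` contributes `(Λ(m)/π) m^{−1/2} liBridgeTail n (log m) T` to `liPrimeTail n T`. -/
def liBridgeTail (n : ℕ) (y T : ℝ) : ℝ :=
  ∫ t in Set.Ioi T, 2 * (1 - Real.cos (n * liZeroAngle t)) * Real.cos (t * y)

/-- The MIDPOINT WEIGHT of `m` at cutoff scale `c`: `1` if `log m < 1/c²` (released: stationary height above the cut),
`½` if `log m = 1/c²` (resonant: ON the cut), `0` if `log m > 1/c²` (not released). -/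
def liMidpointWeight (c : ℝ) (m : ℕ) : ℝ :=
  if Real.log m < 1 / c ^ 2 then 1 else if Real.log m = 1 / c ^ 2 then 1 / 2 else 0

/-! ## The rung leaf -/

/-- **RUNG LEAF «Li TAIL MIDPOINT LAW» (RH-FREE for all `n`; PROOF-OF-DATA; NOT height-buying)** — round 8 of the LI
column; the one case excluded by PART K's leaf `LiZeroTailLaguerre`.  For every prime power `m` (`Λ(m) ≠ 0`), at the
resonant cutoff `c_m√n = √n/√(log m)` and for all `n ≥ 2`:
`|liZeroTail n (c_m√n) − liSmoothTail n (c_m√n) + Σ_{2 ≤ m' < m} liCoffeyTerm m' n + liCoffeyTerm m n / 2| ≤ C_m log² n`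
— the prime powers below `m` are released WHOLE, `m` itself by EXACTLY HALF (stationary point at the endpoint ⇒ half the
Fresnel integral).  DATA: eng-6 g4 exhibit no. 2, kit j258978, PASS ×6 (`m ∈ {2,3,4,5,7,8}`, 221 certified
`n ∈ [10³, 10⁷]`: `R_half` band rms flat 0.8–1.9, growth ≤ 0.07, while weight 0 or 1 leaves `~ ½|E_m| n^{1/4}`); see the
module docstring.  KILL (pre-registered): a resonant cutoff with band-rms growth exponent ≥ 0.2 on a certified `n`-range, or
a normalisation mismatch (`½`, index `n − 1`).  WHAT THIS IS NOT: not evidence for RH, not RH-sensitive, not a positivity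
statement. [mechanism: PART K contour + one-sided stationary phase of the Laguerre bridge; statement new] -/
@[conjecture] def LiZeroTailMidpoint : Prop :=
  ∀ m : ℕ, 2 ≤ m → (Λ m : ℝ) ≠ 0 →
    ∃ C : ℝ, ∀ n : ℕ, 2 ≤ n →
      |liZeroTail n (liResonantScale m * Real.sqrt n) - liSmoothTail n (liResonantScale m * Real.sqrt n)
          + (∑ k ∈ Finset.Ico 2 m, liCoffeyTerm k n) + liCoffeyTerm m n / 2|
        ≤ C * Real.log n ^ 2

/-! ## The unified law (typed target of the family — NOT a route item) and PROVED glue -/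

/-- **«Li TAIL–LAGUERRE LAW, ALL CUTOFFS»** (RH-FREE; typed target, closed by `liZeroTailLaguerreAll_of` from the two
leaves): for EVERY `c > 0` and all `n ≥ 2`,
`|liZeroTail n (c√n) − liSmoothTail n (c√n) + Σ_{2 ≤ m ≤ ⌊e^{1/c²}⌋} w_c(m)·liCoffeyTerm m n| ≤ C_c log² n` with the midpoint
weight `w_c = liMidpointWeight c` (`1, ½, 0` for `log m <, =, > 1/c²`). -/
@[conjecture] def LiZeroTailLaguerreAll : Prop :=
  ∀ c : ℝ, 0 < c →
    ∃ C : ℝ, ∀ n : ℕ, 2 ≤ n →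
      |liZeroTail n (c * Real.sqrt n) - liSmoothTail n (c * Real.sqrt n)
          + ∑ m ∈ Finset.Icc 2 ⌊Real.exp (1 / c ^ 2)⌋₊, liMidpointWeight c m * liCoffeyTerm m n|
        ≤ C * Real.log n ^ 2

/-- `liCoffeyTerm m n = 0` when `m` is not a prime power. -/
theorem liCoffeyTerm_eq_zero_of_vonMangoldt {m : ℕ} (h : (Λ m : ℝ) = 0) (n : ℕ) : liCoffeyTerm m n = 0 := by
  simp [liCoffeyTerm, h]

/-- At a resonance `log m = 1/c²` (`c > 0`) the cutoff IS the resonant one: `c = liResonantScale m`. -/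
theorem eq_liResonantScale_of_log_eq {c : ℝ} (hc : 0 < c) {m : ℕ} (h : Real.log m = 1 / c ^ 2) :
    c = liResonantScale m := by
  unfold liResonantScale
  rw [h, ← one_div_pow, Real.sqrt_sq (le_of_lt (one_div_pos.2 hc)), one_div_one_div]

/-- Glue (PROVED): PART K's leaf and the midpoint leaf give the law at every cutoff with the midpoint convention. -/
theorem liZeroTailLaguerreAll_of (h : LiZeroTailLaguerre) (hM : LiZeroTailMidpoint) : LiZeroTailLaguerreAll := by
  intro c hc
  by_cases hres : ∃ m : ℕ, 2 ≤ m ∧ (Λ m : ℝ) ≠ 0 ∧ Real.log m = 1 / c ^ 2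
  · -- resonant cutoff: `c = c_m`, `⌊e^{1/c²}⌋ = m`, weights `1` below `m` and `½` at `m`
    obtain ⟨m, hm, hΛ, hlog⟩ := hres
    obtain ⟨C, hC⟩ := hM m hm hΛ
    refine ⟨C, fun n hn ↦ ?_⟩
    have hm0 : (0 : ℝ) < m := by exact_mod_cast (show 0 < m by omega)
    have hcm : c = liResonantScale m := eq_liResonantScale_of_log_eq hc hlog
    have hfloor : ⌊Real.exp (1 / c ^ 2)⌋₊ = m := by
      rw [← hlog, Real.exp_log hm0, Nat.floor_natCast]
    have hsum : ∑ k ∈ Finset.Icc 2 ⌊Real.exp (1 / c ^ 2)⌋₊, liMidpointWeight c k * liCoffeyTerm k n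
        = (∑ k ∈ Finset.Ico 2 m, liCoffeyTerm k n) + liCoffeyTerm m n / 2 := by
      rw [hfloor, ← Finset.Ico_add_one_right_eq_Icc, Finset.sum_Ico_succ_top hm]
      congr 1
      · refine Finset.sum_congr rfl fun k hk ↦ ?_
        rw [Finset.mem_Ico] at hk
        have hk0 : (0 : ℝ) < k := by exact_mod_cast (show 0 < k by omega)
        have hlt : Real.log k < 1 / c ^ 2 := by
          rw [← hlog]; exact Real.log_lt_log hk0 (by exact_mod_cast hk.2)
        rw [liMidpointWeight, if_pos hlt, one_mul]
      · rw [liMidpointWeight, if_neg (by rw [hlog]; exact lt_irrefl _), if_pos hlog]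
        ring
    rw [hsum, hcm, ← add_assoc]
    exact hC n hn
  · -- non-resonant cutoff: PART K's leaf; a non-prime-power `m` with `log m = 1/c²` has `liCoffeyTerm m n = 0`
    push Not at hres
    have hedge : ∀ m : ℕ, 2 ≤ m → (Λ m : ℝ) ≠ 0 → Real.log m ≠ 1 / c ^ 2 := fun m hm hΛ ↦ hres m hm hΛ
    obtain ⟨C, hC⟩ := h c hc hedge
    refine ⟨C, fun n hn ↦ ?_⟩
    have hsum : ∑ k ∈ Finset.Icc 2 ⌊Real.exp (1 / c ^ 2)⌋₊, liMidpointWeight c k * liCoffeyTerm k n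
        = ∑ k ∈ Finset.Icc 2 ⌊Real.exp (1 / c ^ 2)⌋₊, liCoffeyTerm k n := by
      refine Finset.sum_congr rfl fun k hk ↦ ?_
      rw [Finset.mem_Icc] at hk
      have hk0 : (0 : ℝ) < k := by exact_mod_cast (show 0 < k by omega)
      have hle : Real.log k ≤ 1 / c ^ 2 := by
        have h1 : (k : ℝ) ≤ Real.exp (1 / c ^ 2) := (Nat.floor_le (Real.exp_pos _).le).trans' (by exact_mod_cast hk.2)
        exact (Real.log_le_log_iff hk0 (Real.exp_pos _)).2 h1 |>.trans_eq (Real.log_exp _)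
      rcases hle.lt_or_eq with hlt | heq
      · rw [liMidpointWeight, if_pos hlt, one_mul]
      · by_cases hΛ : (Λ k : ℝ) = 0
        · simp [liCoffeyTerm_eq_zero_of_vonMangoldt hΛ]
        · exact absurd heq (hedge k hk.1 hΛ)
    rw [hsum]
    exact hC n hn

end Summit.RiemannHypothesis.RiemannHypothesis.Theorems.LiTheory

end
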